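import Literature.Topology.RestrictedProductOpenMap
import Mathlib.Topology.Algebra.Group.Quotient
import Mathlib.GroupTheory.GroupAction.Quotient
import Mathlib.GroupTheory.Subgroup.Centralizer
import HarnessLib

/-!
# Restricted products of coset spaces: `(Πʳ_i G_i) ⧸ (∏_i H_i) ≃ₜ Πʳ_i (G_i ⧸ H_i)`

Topic `Topology`; namespace `Literature.Topology.RestrictedProduct`. Definitions (with bodies) and theorems;
no instance, no notation, no named fact, no `sorry`; imports Mathlib + the tree's `RestrictedProductOpenMap`.

Setting: a family of groups `G i` with subgroups `K i` (the integral structures; OPEN for the topological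
statements) and `H i` (arbitrary, NOT assumed normal — e.g. the local centralisers `G_{γ,i}` of the components of
an adelic point `γ`). Mathlib's restricted product `Πʳ i, [G i, K i]` (filter `cofinite`) is a group; the local
coset spaces `G i ⧸ H i` (left cosets, Mathlib's `HasQuotient` for a `Subgroup`, quotient topology) carry the
base sets

* `quotBase K H i = π_i(K_i) ⊆ G_i ⧸ H_i` (`π_i = QuotientGroup.mk`; open, resp. compact, with `K_i`;
  stable under `K_i`), so that the restricted product `Πʳ i, [G i ⧸ H i, quotBase K H i]` makes sense;
* `piSubgroup K H = {x | ∀ i, x_i ∈ H_i} ≤ Πʳ i, [G i, K i]` — the restricted product of the `H_i` along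
  `H_i ∩ K_i`, as a subgroup; `centralizer_singleton_eq_piSubgroup`: the centraliser of `γ ∈ Πʳ G_i` IS
  `piSubgroup K (i ↦ C_{G_i}(γ_i))`;
* `quotientMap K H = ∏' π_i : Πʳ i, [G i, K i] → Πʳ i, [G i ⧸ H i, quotBase K H i]` — continuous, surjective,
  OPEN (`RestrictedProductOpenMap.isOpenMap_map`: box by box), with fibres the left cosets of `piSubgroup K H`
  (`quotientMap_eq_iff`), the box lemma `image_quotientMap_box` (`(∏' π_i)(A_S) = ` the box of the `π_i(K_i)`
  off `S`) and the coordinatewise equivariance `quotientMap (g * x) i = g_i • quotientMap x i`;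
* for ANY subgroup `M` with `x ∈ M ↔ ∀ i, x_i ∈ H_i` (e.g. `M = piSubgroup K H`, or `M = C(γ)` by the
  centraliser lemma): `quotientLift`, `quotientEquiv` and **`quotientHomeomorph K H M hM hK :
  (Πʳ i, [G i, K i]) ⧸ M ≃ₜ Πʳ i, [G i ⧸ H i, quotBase K H i]`** — the adelic homogeneous space IS the
  restricted product of the local ones (a continuous bijection which is open because `∏' π_i` is);
  `quotientHomeomorph_mk`, `…_symm_quotientMap`, the box transport `preimage_quotientHomeomorph_box`, and
  the equivariance `quotientHomeomorph (g • p) i = g_i • quotientHomeomorph p i` for Mathlib's left action of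
  `Πʳ G_i` on `(Πʳ G_i) ⧸ M`.

This is the carrier of FACTORIZABLE ORBITAL INTEGRALS: `G(𝔸) ⧸ G_γ(𝔸) = Πʳ_v G_v ⧸ G_{γ,v}` w.r.t. the images of
the hyperspecial subgroups (Borel–Jacquet (1979) §4.1 for restricted products of homogeneous data; the Euler
product of orbital integrals, e.g. Gelbart (1975) (9.13)–(9.14), Rogawski (1990) §14.5). The MEASURE half
(restricted product of local invariant measures, invariance, finiteness on compacta) is the business of
`Literature/MeasureTheory/RestrictedProduct/`. Written for the cell `pub/hodgecm-mathlib`, ENGINE T1, plan O13c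
(file Q1b).

## References

* A. Borel, H. Jacquet, *Automorphic forms and automorphic representations*, PSPM 33.1 (1979), §4.1 [BorelJacquet1979].
* S. Gelbart, *Automorphic forms on adele groups*, Ann. of Math. Stud. 83 (1975), (9.13)–(9.14) [Gelbart1975].
* N. Bourbaki, *General Topology*, Ch. I §4, Ch. III §2 (quotients of topological groups) [folklore].
-/


open Set Filter Topology TopologicalSpace Function
open scoped RestrictedProduct Pointwise

namespace Literature.Topology.RestrictedProduct

universe u v

variable {ι : Type u} {G : ι → Type v} [∀ i, Group (G i)]
  (K : ∀ i, Subgroup (G i)) (H : ∀ i, Subgroup (G i))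

/-! ### The local base sets `π_i(K_i) ⊆ G_i ⧸ H_i` -/

/-- The base set of the local coset space `G_i ⧸ H_i` along which the restricted product of the quotients is
formed: the image `π_i(K_i)` of the integral structure `K_i`. [cite: BorelJacquet1979, §4.1] -/
def quotBase (i : ι) : Set (G i ⧸ H i) := (QuotientGroup.mk : G i → G i ⧸ H i) '' (K i : Set (G i))

/-- `quotBase K H i = π_i '' K_i` (definitional). [cite: BorelJacquet1979, §4.1] -/
theorem quotBase_eq (i : ι) :
    quotBase K H i = (QuotientGroup.mk : G i → G i ⧸ H i) '' (K i : Set (G i)) := rfl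

/-- `π_i k ∈ π_i(K_i)` for `k ∈ K_i`. [cite: BorelJacquet1979, §4.1] -/
theorem mk_mem_quotBase {i : ι} {k : G i} (hk : k ∈ K i) : (k : G i ⧸ H i) ∈ quotBase K H i :=
  mem_image_of_mem _ hk

/-- The base point `π_i 1` lies in `π_i(K_i)`. [cite: BorelJacquet1979, §4.1] -/
theorem one_mem_quotBase (i : ι) : ((1 : G i) : G i ⧸ H i) ∈ quotBase K H i :=
  mk_mem_quotBase K H (K i).one_mem

/-- `π_i g ∈ π_i(K_i) ↔ g ∈ K_i H_i`, i.e. `k⁻¹ g ∈ H_i` for some `k ∈ K_i`. [cite: BorelJacquet1979, §4.1] -/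
theorem mk_mem_quotBase_iff {i : ι} {g : G i} :
    (g : G i ⧸ H i) ∈ quotBase K H i ↔ ∃ k ∈ K i, k⁻¹ * g ∈ H i := by
  simp only [quotBase, mem_image, SetLike.mem_coe]
  exact exists_congr fun k => and_congr_right fun _ => QuotientGroup.eq

/-- The base set `π_i(K_i)` is stable under the left action of `K_i` on `G_i ⧸ H_i`. [cite: BorelJacquet1979, §4.1] -/
theorem smul_mem_quotBase {i : ι} {k : G i} (hk : k ∈ K i) {q : G i ⧸ H i} (hq : q ∈ quotBase K H i) :
    k • q ∈ quotBase K H i := by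
  obtain ⟨k', hk', rfl⟩ := hq
  rw [MulAction.Quotient.smul_coe, smul_eq_mul]
  exact mk_mem_quotBase K H ((K i).mul_mem hk hk')

/-- `k • π_i(K_i) = π_i(K_i)` for `k ∈ K_i`. [cite: BorelJacquet1979, §4.1] -/
theorem smul_quotBase_eq {i : ι} {k : G i} (hk : k ∈ K i) : k • quotBase K H i = quotBase K H i := by
  refine Subset.antisymm ?_ fun q hq => ?_
  · rintro _ ⟨q, hq, rfl⟩
    exact smul_mem_quotBase K H hk hq
  · refine ⟨k⁻¹ • q, smul_mem_quotBase K H ((K i).inv_mem hk) hq, ?_⟩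
    simp only [smul_inv_smul]

section Topology

variable [∀ i, TopologicalSpace (G i)] [∀ i, IsTopologicalGroup (G i)]

omit [∀ i, IsTopologicalGroup (G i)] in
/-- `π_i(K_i)` is compact when `K_i` is. [cite: BorelJacquet1979, §4.1] -/
theorem isCompact_quotBase {i : ι} (hK : IsCompact (K i : Set (G i))) : IsCompact (quotBase K H i) :=
  hK.image QuotientGroup.continuous_mk

/-- `π_i(K_i)` is open when `K_i` is (the quotient map of a topological group is open). [cite: BorelJacquet1979, §4.1] -/
theorem isOpen_quotBase {i : ι} (hK : IsOpen (K i : Set (G i))) : IsOpen (quotBase K H i) :=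
  QuotientGroup.isOpenMap_coe _ hK

end Topology

/-! ### The subgroup `∏_i H_i` of the restricted product -/

/-- The subgroup `{x | ∀ i, x_i ∈ H_i}` of `Πʳ i, [G i, K i]` — the restricted product of the `H_i` along the
`H_i ∩ K_i`. [cite: BorelJacquet1979, §4.1] -/
def piSubgroup : Subgroup (Πʳ i, [G i, K i]) where
  carrier := {x | ∀ i, x i ∈ H i}
  mul_mem' {x y} hx hy i := by
    rw [RestrictedProduct.mul_apply]
    exact (H i).mul_mem (hx i) (hy i)
  one_mem' i := by
    rw [RestrictedProduct.one_apply]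
    exact (H i).one_mem
  inv_mem' {x} hx i := by
    rw [RestrictedProduct.inv_apply]
    exact (H i).inv_mem (hx i)

/-- Membership in `piSubgroup K H` is coordinatewise. [cite: BorelJacquet1979, §4.1] -/
theorem mem_piSubgroup_iff {x : Πʳ i, [G i, K i]} : x ∈ piSubgroup K H ↔ ∀ i, x i ∈ H i := Iff.rfl

/-- **The centraliser of an adelic point is the restricted product of the local centralisers**:
`C(γ) = {x | ∀ i, x_i ∈ C_{G_i}(γ_i)}` in `Πʳ i, [G i, K i]`. [cite: BorelJacquet1979, §4.1] -/
theorem centralizer_singleton_eq_piSubgroup (γ : Πʳ i, [G i, K i]) :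
    Subgroup.centralizer ({γ} : Set (Πʳ i, [G i, K i])) =
      piSubgroup K (fun i => Subgroup.centralizer ({γ i} : Set (G i))) := by
  ext x
  rw [Subgroup.mem_centralizer_singleton_iff, mem_piSubgroup_iff]
  constructor
  · intro h i
    rw [Subgroup.mem_centralizer_singleton_iff, ← RestrictedProduct.mul_apply, h, RestrictedProduct.mul_apply]
  · intro h
    exact RestrictedProduct.ext _ _ fun i => by
      rw [RestrictedProduct.mul_apply, RestrictedProduct.mul_apply]
      exact Subgroup.mem_centralizer_singleton_iff.1 (h i)

/-- Coordinatewise form of `x ∈ C(γ)`: `∀ i, x_i γ_i = γ_i x_i`. [cite: BorelJacquet1979, §4.1] -/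
theorem mem_centralizer_singleton_iff_forall (γ x : Πʳ i, [G i, K i]) :
    x ∈ Subgroup.centralizer ({γ} : Set (Πʳ i, [G i, K i])) ↔ ∀ i, x i * γ i = γ i * x i := by
  rw [centralizer_singleton_eq_piSubgroup, mem_piSubgroup_iff]
  exact forall_congr' fun i => Subgroup.mem_centralizer_singleton_iff

/-! ### The product of the quotient maps `∏' π_i` -/

/-- **The product quotient map** `∏' π_i : Πʳ i, [G i, K i] → Πʳ i, [G i ⧸ H i, π_i(K_i)]`,
`(x_i)_i ↦ (x_i H_i)_i`. [cite: BorelJacquet1979, §4.1] -/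
def quotientMap : (Πʳ i, [G i, K i]) → Πʳ i, [G i ⧸ H i, quotBase K H i] :=
  RestrictedProduct.map (fun i => (QuotientGroup.mk : G i → G i ⧸ H i))
    (Eventually.of_forall fun _ => mapsTo_image _ _)

/-- Coordinates of `∏' π_i`. [cite: BorelJacquet1979, §4.1] -/
@[simp] theorem quotientMap_apply (x : Πʳ i, [G i, K i]) (i : ι) :
    quotientMap K H x i = ((x i : G i) : G i ⧸ H i) := rfl

/-- **Fibres of `∏' π_i` are the left cosets of `∏ H_i`**: `π(x) = π(y) ↔ x⁻¹ y ∈ piSubgroup K H`. [cite: BorelJacquet1979, §4.1] -/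
theorem quotientMap_eq_iff {x y : Πʳ i, [G i, K i]} :
    quotientMap K H x = quotientMap K H y ↔ x⁻¹ * y ∈ piSubgroup K H := by
  rw [mem_piSubgroup_iff]
  constructor
  · intro h i
    have hi := congrArg (fun z => z i) h
    simp only [quotientMap_apply] at hi
    rw [RestrictedProduct.mul_apply, RestrictedProduct.inv_apply]
    exact QuotientGroup.eq.1 hi
  · intro h
    refine RestrictedProduct.ext _ _ fun i => ?_
    rw [quotientMap_apply, quotientMap_apply]
    have hi := h i
    rw [RestrictedProduct.mul_apply, RestrictedProduct.inv_apply] at hi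
    exact QuotientGroup.eq.2 hi

/-- `∏' π_i` is constant on left cosets of `∏ H_i`. [cite: BorelJacquet1979, §4.1] -/
theorem quotientMap_mul_of_mem (x : Πʳ i, [G i, K i]) {h : Πʳ i, [G i, K i]} (hh : h ∈ piSubgroup K H) :
    quotientMap K H (x * h) = quotientMap K H x :=
  ((quotientMap_eq_iff K H).2 (by rwa [inv_mul_cancel_left])).symm

/-- `∏' π_i` is surjective (every point lifts, inside `K_i` off its finite exceptional set). [cite: BorelJacquet1979, §4.1] -/
theorem quotientMap_surjective : Surjective (quotientMap K H) :=
  map_surjective _ _ (fun _ => QuotientGroup.mk_surjective) fun _ => Subset.rfl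

/-- **Coordinatewise equivariance**: `(∏' π_i)(g x)_i = g_i • (∏' π_i)(x)_i` for the left action of `G_i` on
`G_i ⧸ H_i`. [cite: BorelJacquet1979, §4.1] -/
theorem quotientMap_mul_apply (g x : Πʳ i, [G i, K i]) (i : ι) :
    quotientMap K H (g * x) i = g i • quotientMap K H x i := by
  rw [quotientMap_apply, quotientMap_apply, RestrictedProduct.mul_apply, MulAction.Quotient.smul_coe,
    smul_eq_mul]

/-- **The box lemma**: `(∏' π_i) {x | x_i ∈ K_i (i ∉ S)} = {z | z_i ∈ π_i(K_i) (i ∉ S)}` — images of the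
cylinders `A_S` are the cylinders of the quotient data. [cite: BorelJacquet1979, §4.1] -/
theorem image_quotientMap_box (S : Finset ι) :
    quotientMap K H '' {x : Πʳ i, [G i, K i] | ∀ i, i ∉ S → x i ∈ (K i : Set (G i))} =
      {z : Πʳ i, [G i ⧸ H i, quotBase K H i] | ∀ i, i ∉ S → z i ∈ quotBase K H i} := by
  classical
  refine Subset.antisymm ?_ fun z hz => ?_
  · rintro _ ⟨x, hx, rfl⟩ i hi
    exact mk_mem_quotBase K H (hx i hi)
  · -- choose preimages: in `K i` off `S`, anything on `S`
    have hoff : ∀ i, i ∉ S → ∃ k : G i, k ∈ K i ∧ (k : G i ⧸ H i) = z i := fun i hi => by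
      obtain ⟨k, hk, hkz⟩ := hz i hi
      exact ⟨k, hk, hkz⟩
    let x : Π i, G i := fun i =>
      if hi : i ∈ S then Quotient.out (z i) else (hoff i hi).choose
    have hxS : ∀ i, i ∉ S → x i ∈ K i ∧ (x i : G i ⧸ H i) = z i := fun i hi => by
      simp only [x, dif_neg hi]
      exact (hoff i hi).choose_spec
    have hx : ∀ᶠ i in cofinite, x i ∈ (K i : Set (G i)) :=
      eventually_cofinite.2 (S.finite_toSet.subset fun i hi => by
        by_contra hiS
        exact hi (hxS i (fun h => hiS (Finset.mem_coe.2 h))).1)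
    refine ⟨⟨x, hx⟩, fun i hi => (hxS i hi).1, RestrictedProduct.ext _ _ fun i => ?_⟩
    rw [quotientMap_apply]
    by_cases hi : i ∈ S
    · show ((x i : G i) : G i ⧸ H i) = z i
      simp only [x, dif_pos hi]
      exact QuotientGroup.out_eq' (z i)
    · exact (hxS i hi).2

/-- The cylinder `A_S` lies in the preimage of the quotient cylinder. [cite: BorelJacquet1979, §4.1] -/
theorem box_subset_preimage_quotientMap_box (S : Finset ι) :
    {x : Πʳ i, [G i, K i] | ∀ i, i ∉ S → x i ∈ (K i : Set (G i))} ⊆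
      quotientMap K H ⁻¹' {z | ∀ i, i ∉ S → z i ∈ quotBase K H i} :=
  fun _ hx i hi => mk_mem_quotBase K H (hx i hi)

/-- The preimage of the quotient cylinder: `x_i ∈ K_i H_i` off `S`. [cite: BorelJacquet1979, §4.1] -/
theorem preimage_quotientMap_box (S : Finset ι) :
    quotientMap K H ⁻¹' {z | ∀ i, i ∉ S → z i ∈ quotBase K H i} =
      {x : Πʳ i, [G i, K i] | ∀ i, i ∉ S → ∃ k ∈ K i, k⁻¹ * x i ∈ H i} := by
  ext x
  simp only [mem_preimage, mem_setOf_eq, quotientMap_apply, mk_mem_quotBase_iff]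

section Topology

variable [∀ i, TopologicalSpace (G i)] [∀ i, IsTopologicalGroup (G i)]

omit [∀ i, IsTopologicalGroup (G i)] in
/-- `∏' π_i` is continuous. [cite: BorelJacquet1979, §4.1] -/
theorem continuous_quotientMap : Continuous (quotientMap K H) :=
  continuous_map _ _ fun _ => QuotientGroup.continuous_mk

/-- **`∏' π_i` is an open map** (for open `K_i`): box by box, `RestrictedProductOpenMap.isOpenMap_map`.
[cite: BorelJacquet1979, §4.1] -/
theorem isOpenMap_quotientMap (hK : ∀ i, IsOpen (K i : Set (G i))) : IsOpenMap (quotientMap K H) :=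
  isOpenMap_map hK (fun i => isOpen_quotBase K H (hK i)) _ _ (fun _ => QuotientGroup.isOpenMap_coe)
    fun _ => rfl

/-- `∏' π_i` is an open quotient map (for open `K_i`). [cite: BorelJacquet1979, §4.1] -/
theorem isOpenQuotientMap_quotientMap (hK : ∀ i, IsOpen (K i : Set (G i))) :
    IsOpenQuotientMap (quotientMap K H) :=
  isOpenQuotientMap_map hK (fun i => isOpen_quotBase K H (hK i)) _ _ (fun _ => QuotientGroup.isOpenMap_coe)
    (fun _ => QuotientGroup.continuous_mk) (fun _ => QuotientGroup.mk_surjective) fun _ => rfl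

end Topology

/-! ### The homeomorphism `(Πʳ G_i) ⧸ M ≃ₜ Πʳ (G_i ⧸ H_i)` for a subgroup `M` with coordinatewise membership -/

section Lift

variable (M : Subgroup (Πʳ i, [G i, K i])) (hM : ∀ x : Πʳ i, [G i, K i], x ∈ M ↔ ∀ i, x i ∈ H i)

include hM in
/-- Fibres of `∏' π_i` are the left cosets of `M` (when membership in `M` is coordinatewise in the `H_i`). [cite: BorelJacquet1979, §4.1] -/
theorem quotientMap_eq_iff_of_forall {x y : Πʳ i, [G i, K i]} :
    quotientMap K H x = quotientMap K H y ↔ x⁻¹ * y ∈ M := by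
  rw [quotientMap_eq_iff, mem_piSubgroup_iff, hM]

/-- `∏' π_i` descended to the coset space `(Πʳ G_i) ⧸ M`. [cite: BorelJacquet1979, §4.1] -/
def quotientLift : (Πʳ i, [G i, K i]) ⧸ M → Πʳ i, [G i ⧸ H i, quotBase K H i] :=
  Quotient.lift (quotientMap K H) fun _ _ h =>
    (quotientMap_eq_iff_of_forall K H M hM).2 (QuotientGroup.leftRel_apply.1 h)

/-- `quotientLift (x M) = (∏' π_i)(x)`. [cite: BorelJacquet1979, §4.1] -/
@[simp] theorem quotientLift_mk (x : Πʳ i, [G i, K i]) :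
    quotientLift K H M hM (QuotientGroup.mk x) = quotientMap K H x := rfl

/-- `quotientLift ∘ QuotientGroup.mk = ∏' π_i`. [cite: BorelJacquet1979, §4.1] -/
theorem quotientLift_comp_mk : quotientLift K H M hM ∘ QuotientGroup.mk = quotientMap K H := rfl

/-- `quotientLift` is injective. [cite: BorelJacquet1979, §4.1] -/
theorem quotientLift_injective : Injective (quotientLift K H M hM) := by
  intro p q
  induction p using QuotientGroup.induction_on with
  | H x =>
    induction q using QuotientGroup.induction_on with
    | H y =>
      intro h
      rw [quotientLift_mk, quotientLift_mk] at h
      exact QuotientGroup.eq.2 ((quotientMap_eq_iff_of_forall K H M hM).1 h)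

/-- `quotientLift` is surjective. [cite: BorelJacquet1979, §4.1] -/
theorem quotientLift_surjective : Surjective (quotientLift K H M hM) := fun z => by
  obtain ⟨x, rfl⟩ := quotientMap_surjective K H z
  exact ⟨QuotientGroup.mk x, rfl⟩

/-- `quotientLift` is bijective. [cite: BorelJacquet1979, §4.1] -/
theorem quotientLift_bijective : Bijective (quotientLift K H M hM) :=
  ⟨quotientLift_injective K H M hM, quotientLift_surjective K H M hM⟩

/-- The bijection `(Πʳ G_i) ⧸ M ≃ Πʳ (G_i ⧸ H_i)` as an `Equiv`. [cite: BorelJacquet1979, §4.1] -/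
noncomputable def quotientEquiv : (Πʳ i, [G i, K i]) ⧸ M ≃ Πʳ i, [G i ⧸ H i, quotBase K H i] :=
  Equiv.ofBijective (quotientLift K H M hM) (quotientLift_bijective K H M hM)

/-- `quotientEquiv (x M) = (∏' π_i)(x)`. [cite: BorelJacquet1979, §4.1] -/
@[simp] theorem quotientEquiv_mk (x : Πʳ i, [G i, K i]) :
    quotientEquiv K H M hM (QuotientGroup.mk x) = quotientMap K H x := rfl

/-- The image of the quotient cylinder under `quotientEquiv.symm` is the image of `A_S` in the coset space.
[cite: BorelJacquet1979, §4.1] -/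
theorem image_mk_box_eq_preimage_quotientEquiv (S : Finset ι) :
    (QuotientGroup.mk : (Πʳ i, [G i, K i]) → (Πʳ i, [G i, K i]) ⧸ M) ''
        {x | ∀ i, i ∉ S → x i ∈ (K i : Set (G i))} =
      quotientEquiv K H M hM ⁻¹' {z | ∀ i, i ∉ S → z i ∈ quotBase K H i} := by
  rw [← image_quotientMap_box K H S, ← quotientLift_comp_mk K H M hM, image_comp]
  exact ((quotientEquiv K H M hM).preimage_image _).symm

section Topology

variable [∀ i, TopologicalSpace (G i)] [∀ i, IsTopologicalGroup (G i)]

omit [∀ i, IsTopologicalGroup (G i)] in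
/-- `quotientLift` is continuous (quotient topology on `(Πʳ G_i) ⧸ M`). [cite: BorelJacquet1979, §4.1] -/
theorem continuous_quotientLift : Continuous (quotientLift K H M hM) :=
  (QuotientGroup.isQuotientMap_mk M).continuous_iff.2 (continuous_quotientMap K H)

/-- `quotientLift` is an open map (for open `K_i`): the image of an open `U` is `(∏' π_i)(π_M⁻¹ U)`.
[cite: BorelJacquet1979, §4.1] -/
theorem isOpenMap_quotientLift (hK : ∀ i, IsOpen (K i : Set (G i))) : IsOpenMap (quotientLift K H M hM) := by
  intro U hU
  have hUeq : quotientLift K H M hM '' U =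
      quotientMap K H '' ((QuotientGroup.mk : _ → (Πʳ i, [G i, K i]) ⧸ M) ⁻¹' U) := by
    refine Subset.antisymm ?_ ?_
    · rintro _ ⟨p, hp, rfl⟩
      obtain ⟨x, rfl⟩ := QuotientGroup.mk_surjective p
      exact ⟨x, hp, rfl⟩
    · rintro _ ⟨x, hx, rfl⟩
      exact ⟨QuotientGroup.mk x, hx, rfl⟩
  rw [hUeq]
  exact isOpenMap_quotientMap K H hK _ (hU.preimage QuotientGroup.continuous_mk)

/-- **The adelic coset space is the restricted product of the local coset spaces**: for open `K_i` and a
subgroup `M ≤ Πʳ i, [G i, K i]` with `x ∈ M ↔ ∀ i, x_i ∈ H_i` (e.g. `M = piSubgroup K H`, or `M = C(γ)` and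
`H_i = C(γ_i)` by `centralizer_singleton_eq_piSubgroup`), `x M ↦ (x_i H_i)_i` is a homeomorphism
`(Πʳ i, [G i, K i]) ⧸ M ≃ₜ Πʳ i, [G i ⧸ H i, π_i(K_i)]` — a continuous bijection, open because `∏' π_i` is.
[cite: BorelJacquet1979, §4.1] -/
noncomputable def quotientHomeomorph (hK : ∀ i, IsOpen (K i : Set (G i))) :
    (Πʳ i, [G i, K i]) ⧸ M ≃ₜ Πʳ i, [G i ⧸ H i, quotBase K H i] :=
  (quotientEquiv K H M hM).toHomeomorphOfContinuousOpen (continuous_quotientLift K H M hM)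
    (isOpenMap_quotientLift K H M hM hK)

/-- `quotientHomeomorph (x M) = (∏' π_i)(x)`. [cite: BorelJacquet1979, §4.1] -/
@[simp] theorem quotientHomeomorph_mk (hK : ∀ i, IsOpen (K i : Set (G i))) (x : Πʳ i, [G i, K i]) :
    quotientHomeomorph K H M hM hK (QuotientGroup.mk x) = quotientMap K H x := rfl

/-- `⇑(quotientHomeomorph …) = quotientLift …`. [cite: BorelJacquet1979, §4.1] -/
theorem coe_quotientHomeomorph (hK : ∀ i, IsOpen (K i : Set (G i))) :
    ⇑(quotientHomeomorph K H M hM hK) = quotientLift K H M hM := rfl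

/-- `quotientHomeomorph ∘ QuotientGroup.mk = ∏' π_i`. [cite: BorelJacquet1979, §4.1] -/
theorem quotientHomeomorph_comp_mk (hK : ∀ i, IsOpen (K i : Set (G i))) :
    quotientHomeomorph K H M hM hK ∘ QuotientGroup.mk = quotientMap K H := rfl

/-- `quotientHomeomorph.symm ((∏' π_i)(x)) = x M`. [cite: BorelJacquet1979, §4.1] -/
theorem quotientHomeomorph_symm_quotientMap (hK : ∀ i, IsOpen (K i : Set (G i))) (x : Πʳ i, [G i, K i]) :
    (quotientHomeomorph K H M hM hK).symm (quotientMap K H x) = QuotientGroup.mk x :=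
  (Homeomorph.symm_apply_eq _).2 (quotientHomeomorph_mk K H M hM hK x).symm

/-- **Box transport**: the preimage of the quotient cylinder `{z | z_i ∈ π_i(K_i), i ∉ S}` under the
homeomorphism is the image `π_M(A_S)` of the cylinder `A_S = {x | x_i ∈ K_i, i ∉ S}`. [cite: BorelJacquet1979, §4.1] -/
theorem preimage_quotientHomeomorph_box (hK : ∀ i, IsOpen (K i : Set (G i))) (S : Finset ι) :
    quotientHomeomorph K H M hM hK ⁻¹' {z | ∀ i, i ∉ S → z i ∈ quotBase K H i} =
      (QuotientGroup.mk : (Πʳ i, [G i, K i]) → (Πʳ i, [G i, K i]) ⧸ M) ''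
        {x | ∀ i, i ∉ S → x i ∈ (K i : Set (G i))} :=
  (image_mk_box_eq_preimage_quotientEquiv K H M hM S).symm

/-- The same as an image under `quotientHomeomorph.symm`. [cite: BorelJacquet1979, §4.1] -/
theorem image_quotientHomeomorph_symm_box (hK : ∀ i, IsOpen (K i : Set (G i))) (S : Finset ι) :
    (quotientHomeomorph K H M hM hK).symm '' {z | ∀ i, i ∉ S → z i ∈ quotBase K H i} =
      (QuotientGroup.mk : (Πʳ i, [G i, K i]) → (Πʳ i, [G i, K i]) ⧸ M) ''
        {x | ∀ i, i ∉ S → x i ∈ (K i : Set (G i))} := by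
  rw [Homeomorph.image_symm]
  exact preimage_quotientHomeomorph_box K H M hM hK S

/-- The image of `π_M(A_S)` under the homeomorphism is the quotient cylinder. [cite: BorelJacquet1979, §4.1] -/
theorem image_quotientHomeomorph_mk_box (hK : ∀ i, IsOpen (K i : Set (G i))) (S : Finset ι) :
    quotientHomeomorph K H M hM hK ''
        ((QuotientGroup.mk : (Πʳ i, [G i, K i]) → (Πʳ i, [G i, K i]) ⧸ M) ''
          {x | ∀ i, i ∉ S → x i ∈ (K i : Set (G i))}) =
      {z | ∀ i, i ∉ S → z i ∈ quotBase K H i} := by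
  rw [← preimage_quotientHomeomorph_box K H M hM hK S, Homeomorph.image_preimage]

/-- **Equivariance**: for Mathlib's left action of `Πʳ G_i` on `(Πʳ G_i) ⧸ M`,
`quotientHomeomorph (g • p)_i = g_i • (quotientHomeomorph p)_i`. [cite: BorelJacquet1979, §4.1] -/
theorem quotientHomeomorph_smul_apply (hK : ∀ i, IsOpen (K i : Set (G i))) (g : Πʳ i, [G i, K i])
    (p : (Πʳ i, [G i, K i]) ⧸ M) (i : ι) :
    quotientHomeomorph K H M hM hK (g • p) i = g i • quotientHomeomorph K H M hM hK p i := by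
  obtain ⟨x, rfl⟩ := QuotientGroup.mk_surjective p
  rw [MulAction.Quotient.smul_mk, smul_eq_mul, quotientHomeomorph_mk, quotientHomeomorph_mk,
    quotientMap_mul_apply]

end Topology

end Lift

end Literature.Topology.RestrictedProduct
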